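import Literature.NumberTheory.Automorphic.FixedCosetsStableLattices               -- ★ p840069 (D4½): cosets ↔ lattices, `natCard_fixedBy_unitary_eq_ncard`
import Literature.NumberTheory.Automorphic.UnitaryUnitOrbitalIntegralFixedPoints   -- ★ p839994 (L2 dress): `classOrbitalIntegral_indicator_cmLocalIntegralLevel_eq_natCard_fixedBy`
import Literature.NumberTheory.Automorphic.LocalUnitaryIntegralLevel               -- ★ `localNonsplitEquiv`, `mem_localIntegralLevel_iff_of_smul_eq`, `cmLocalIntegralLevel`
import HarnessLib

/-!
# The lattice-count socket of the inert unit fundamental lemma: at a non-split place the unit orbital integral of `U(H)(L⁺_v)` at an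
# elliptic regular class is the NUMBER OF `γ`-STABLE SELF-DUAL `𝒪_w`-LATTICES
(Kottwitz, *Base change for unit elements of Hecke algebras* (1986), §3; Laumon (1996), Lemma (5.3.2); Rogawski (1990), §4.9 Prop. 4.9.1 (b), Lemma 4.9.3)

Topic `NumberTheory/Automorphic`; namespace `Literature.NumberTheory.Automorphic`.  THEOREMS ONLY (no definition, no instance, no notation, no named fact,
no `sorry`).  Cell `pub/hodgecm-mathlib`, F0∕P3a, road «D-N7-inert» (A-p06 map 84809157), brick «(L2)+(D4½) ⇒ THE LATTICE-COUNT SOCKET» (LEAD F0P3a-plan (g9)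
WORD T8-22 (B)(3)).  HC_CM is proved only modulo the printed citations until rung 0 closes; nothing printed is asserted here.

THE CHAIN, BY NAME.  ★ p839994 `classOrbitalIntegral_indicator_cmLocalIntegralLevel_eq_natCard_fixedBy`: for `m` canonical, `γ ∈ U(H)(L⁺_v)` regular with COMPACT
centraliser and `ν(K_v) = 1`, `Φ(⟦γ⟧, 1_{K_v}; m) = Nat.card Fix_γ(U(H)(L⁺_v) ⧸ K_v)`, `K_v = cmLocalIntegralLevel L N H v`.  At a NON-SPLIT `v` (one place `w ∣ v`,
`c • w = w`) the one-place model ★ `localNonsplitEquiv : U(H)(L⁺_v) ≃ₜ* U(σ_w, H_w)(L_w)` (matrix group over the FIELD `L_w`, `σ_w = galAdicCompletionMap c hw`,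
`H_w = placeForm H w`) matches the integral levels (★ `mem_localIntegralLevel_iff_of_smul_eq`: `g ∈ K_v ↔ g_w ∈ GL_N(𝒪_w)`), and fixed points of `γ` on
`G ⧸ K` transport along any group isomorphism matching the levels (§1).  On the model, ★ (D4½) `natCard_fixedBy_unitary_eq_ncard` reads `Nat.card Fix` as the
number of `γ_w`-stable lattices `Λ(u) = u 𝒪_wᴺ`, `u ∈ U(σ_w, H_w)`, and at an UNRAMIFIED hyperspecial `v` (`H_w ∈ GL_N(𝒪_w)`) these are exactly the `γ_w`-stable
lattices `Λ(g)` with UNIMODULAR GRAM MATRIX `(σ_w g)ᵀ H_w g ∈ GL_N(𝒪_w)` — the self-dual ones (★ L1 `exists_mem_unitaryGroupOfForm_mul_of_selfDual_of_nonsplit`,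
[Jacobowitz1962, Thm. 7.1]).  Hence THE SOCKET: **`Φ(⟦γ⟧, 1_{K_v}; m) = #{Λ = g 𝒪_wᴺ : (σ_w g)ᵀ H_w g ∈ GL_N(𝒪_w), γ_w Λ = Λ}`** — the number the held count
(L3) computes for `N = 3`, elliptic `γ` of torus type `(E¹_w)³` ∕ `E¹_w × L¹`.

* §1 `exists_equiv_fixedBy_quotient_congr`, **`natCard_fixedBy_quotient_congr`** (`e : G ≃* G′` with `g ∈ K ↔ e g ∈ K′` ⇒ `#Fix_γ(G⧸K) = #Fix_{eγ}(G′⧸K′)`).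
* §2 **`natCard_fixedBy_cmLocalIntegralLevel_eq_ncard_of_smul_eq`** (non-split `v`: `Nat.card Fix_γ(U(H)(L⁺_v) ⧸ K_v) = #{Λ(u), u ∈ U(σ_w,H_w)(L_w) | γ_w Λ = Λ}`).
* §3 `exists_mem_unitary_span_eq_iff_selfDual_of_nonsplit` (unramified hyperspecial: the `U(σ_w,H_w)`-orbit of `𝒪_wᴺ` = the lattices with unimodular Gram matrix),
  **`classOrbitalIntegral_indicator_cmLocalIntegralLevel_eq_ncard_selfDual`** (THE SOCKET, `ℝ`-valued) and its `ℂ` twin.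

## References
* [Kottwitz1986] R. E. Kottwitz, Compositio Math. 60 (1986), §3. [Laumon1995] G. Laumon, *Cohomology of Drinfeld Modular Varieties* I (1996), (4.3.11),
  Lemma (5.3.2). [Rogawski1990] J. D. Rogawski, Ann. of Math. Stud. 123 (1990), §4.9 Prop. 4.9.1 (b) p. 55, Lemma 4.9.3. [Jacobowitz1962] R. Jacobowitz, Amer. J.
  Math. 84 (1962), §7 Thm. 7.1. [Kottwitz1992] R. E. Kottwitz, JAMS 5 (1992), §7 Cor. 7.3. [PlatonovRapinchuk1994] §5.1.
-/

set_option autoImplicit false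

noncomputable section

open scoped ValuativeRel Matrix MatrixGroups
open Set MeasureTheory NumberField IsDedekindDomain

namespace Literature.NumberTheory.Automorphic

open UnitaryGroup Literature.NumberTheory.Rogawski1990

/-! ## §1 Fixed cosets transport along a group isomorphism matching the levels -/

section Congr

variable {G G' : Type*} [Group G] [Group G'] (K : Subgroup G) (K' : Subgroup G') (e : G ≃* G')

/-- **`Fix_γ(G ⧸ K) ≃ Fix_{e γ}(G′ ⧸ K′)`** for a group isomorphism `e : G ≃* G′` with `g ∈ K ↔ e g ∈ K′` (`gK ↦ e(g)K′`). [cite: Kottwitz1986, §3] -/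
theorem exists_equiv_fixedBy_quotient_congr (hK : ∀ g : G, g ∈ K ↔ e g ∈ K') (γ : G) :
    ∃ Φ : MulAction.fixedBy (G ⧸ K) γ ≃ MulAction.fixedBy (G' ⧸ K') (e γ),
      ∀ (g : G) (h : (g : G ⧸ K) ∈ MulAction.fixedBy (G ⧸ K) γ), ((Φ ⟨(g : G ⧸ K), h⟩ : MulAction.fixedBy (G' ⧸ K') (e γ)) : G' ⧸ K') = (e g : G' ⧸ K') := by
  -- the bijection of coset spaces
  let Ψ : G ⧸ K ≃ G' ⧸ K' :=
    Quotient.congr (e : G ≃ G') fun a b => by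
      rw [QuotientGroup.leftRel_apply, QuotientGroup.leftRel_apply, hK, map_mul, map_inv]
      rfl
  have hΨ : ∀ g : G, Ψ (g : G ⧸ K) = (e g : G' ⧸ K') := fun g => Quotient.congr_mk _ _ g
  have key : ∀ q : G ⧸ K, q ∈ MulAction.fixedBy (G ⧸ K) γ ↔ Ψ q ∈ MulAction.fixedBy (G' ⧸ K') (e γ) := by
    intro q
    induction q using QuotientGroup.induction_on with
    | H g => rw [hΨ, mem_fixedBy_quotient_mk_iff, mem_fixedBy_quotient_mk_iff, hK, map_mul, map_mul, map_inv]
  exact ⟨Ψ.subtypeEquiv key, fun g h => by rw [Equiv.subtypeEquiv_apply]; exact hΨ g⟩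

/-- **`Nat.card Fix_γ(G ⧸ K) = Nat.card Fix_{e γ}(G′ ⧸ K′)`** for `e : G ≃* G′` with `g ∈ K ↔ e g ∈ K′`. [cite: Kottwitz1986, §3] -/
theorem natCard_fixedBy_quotient_congr (hK : ∀ g : G, g ∈ K ↔ e g ∈ K') (γ : G) :
    Nat.card (MulAction.fixedBy (G ⧸ K) γ) = Nat.card (MulAction.fixedBy (G' ⧸ K') (e γ)) := by
  obtain ⟨Φ, -⟩ := exists_equiv_fixedBy_quotient_congr K K' e hK γ
  exact Nat.card_congr Φ

end Congr

/-! ## §2 Non-split places: `Fix_γ(U(H)(L⁺_v) ⧸ K_v)` counted as `γ_w`-stable lattices on the one-place model -/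

section Nonsplit

variable (L : Type) [Field L] [NumberField L] [IsCMField L] (N : ℕ) (H : Matrix (Fin N) (Fin N) L)
  {v : HeightOneSpectrum (𝓞 ↥(maximalRealSubfield L))} (hc : IsCMField.complexConj L ≠ 1)
  (w : UnitaryGroup.PlacesOver L v) (hw : IsCMField.complexConj L • w.1 = w.1)


/-- **`Nat.card Fix_γ(U(H)(L⁺_v) ⧸ U(H)(𝒪_v)) = #{Λ(u), u ∈ U(σ_w, H_w)(L_w) | γ_w Λ(u) = Λ(u)}` at a NON-SPLIT place** (`w` the place above `v`, `c • w = w`;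
`γ_w = localNonsplitEquiv … γ` the image of `γ` in the one-place model, `Λ(u)` the `𝒪_w`-span of the columns of `u`; `hJw : IsUnit H_w` only names `H_w` as an element of
`GL_N(L_w)` for ★ (D4½)).  ★ `localNonsplitEquiv` + ★ `mem_localIntegralLevel_iff_of_smul_eq` + §1 + ★ `natCard_fixedBy_unitary_eq_ncard`.
[cite: Kottwitz1986, §3] [cite: PlatonovRapinchuk1994, §5.1] [cite: Laumon1995, Lemma (5.3.2) p. 136] -/
theorem natCard_fixedBy_cmLocalIntegralLevel_eq_ncard_of_smul_eq (hJw : IsUnit (placeForm H w.1)) (γ : (cmDatum L N H).Local v) :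
    Nat.card (MulAction.fixedBy ((cmDatum L N H).Local v ⧸ cmLocalIntegralLevel L N H v) γ) =
      {Λ : Submodule 𝒪[w.1.adicCompletion L] (Fin N → w.1.adicCompletion L) |
        (∃ u ∈ unitaryGroupOfForm (galAdicCompletionMap (L := L) (IsCMField.complexConj L) hw) (placeForm H w.1),
            Λ = Submodule.span 𝒪[w.1.adicCompletion L] (Set.range ((u : Matrix (Fin N) (Fin N) (w.1.adicCompletion L)))ᵀ)) ∧
          Λ.map ((Matrix.toLin' (((localNonsplitEquiv (IsCMField.complexConj L) H hc w hw γ :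
              unitaryGroupOfForm (galAdicCompletionMap (L := L) (IsCMField.complexConj L) hw) (placeForm H w.1)) :
                GL (Fin N) (w.1.adicCompletion L)) : Matrix (Fin N) (Fin N) (w.1.adicCompletion L))).restrictScalars 𝒪[w.1.adicCompletion L]) = Λ}.ncard := by
  rw [natCard_fixedBy_quotient_congr (cmLocalIntegralLevel L N H v)
    ((glInt N (w.1.adicCompletion L)).subgroupOf
      (unitaryGroupOfForm (galAdicCompletionMap (L := L) (IsCMField.complexConj L) hw)
        ((hJw.unit : GL (Fin N) (w.1.adicCompletion L)) : Matrix (Fin N) (Fin N) (w.1.adicCompletion L))))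
    (localNonsplitEquiv (IsCMField.complexConj L) H hc w hw).toMulEquiv
    (fun g => by rw [Subgroup.mem_subgroupOf]; exact mem_localIntegralLevel_iff_of_smul_eq (IsCMField.complexConj L) N H hc w hw g) γ]
  exact natCard_fixedBy_unitary_eq_ncard (galAdicCompletionMap (L := L) (IsCMField.complexConj L) hw) hJw.unit
    ((localNonsplitEquiv (IsCMField.complexConj L) H hc w hw).toMulEquiv γ)

/-! ## §3 Unramified hyperspecial `v`: the `U(σ_w, H_w)`-orbit of `𝒪_wᴺ` is the set of self-dual lattices — THE SOCKET -/

include hc in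
/-- **At an unramified non-split place with `H_w ∈ GL_N(𝒪_w)`: `Λ = Λ(u)` for some `u ∈ U(σ_w, H_w)(L_w)` iff `Λ = Λ(g)` for some `g` with unimodular Gram matrix
`(σ_w g)ᵀ H_w g`** (the self-dual locus is `U · GL_N(𝒪_w)`, ★ L1 `exists_mem_unitaryGroupOfForm_mul_of_selfDual_of_nonsplit`; the easy direction is
`(σ_w u)ᵀ H_w u = H_w`). [cite: Jacobowitz1962, §7 Thm. 7.1] [cite: Kottwitz1992, §7 Cor. 7.3] -/
theorem exists_mem_unitary_span_eq_iff_selfDual_of_nonsplit (hv : Algebra.IsUnramifiedIn (𝓞 L) v.asIdeal)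
    (hH : (H.map (cmConjRingHom L))ᵀ = H) (hJw : IsUnit (placeForm H w.1)) (hJi : hJw.unit ∈ glInt N (w.1.adicCompletion L))
    (Λ : Submodule 𝒪[w.1.adicCompletion L] (Fin N → w.1.adicCompletion L)) :
    (∃ u ∈ unitaryGroupOfForm (galAdicCompletionMap (L := L) (IsCMField.complexConj L) hw) (placeForm H w.1),
        Λ = Submodule.span 𝒪[w.1.adicCompletion L] (Set.range ((u : Matrix (Fin N) (Fin N) (w.1.adicCompletion L)))ᵀ)) ↔
      ∃ g : GL (Fin N) (w.1.adicCompletion L),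
        (∃ J' ∈ glInt N (w.1.adicCompletion L), (J' : Matrix (Fin N) (Fin N) (w.1.adicCompletion L)) =
          formCongr (galAdicCompletionMap (L := L) (IsCMField.complexConj L) hw) g (placeForm H w.1)) ∧
        Λ = Submodule.span 𝒪[w.1.adicCompletion L] (Set.range ((g : Matrix (Fin N) (Fin N) (w.1.adicCompletion L)))ᵀ) := by
  have hHc : (H.map (IsCMField.complexConj L))ᵀ = H := by rw [← map_cmConjRingHom_eq_map_complexConj]; exact hH
  have hJh : (((hJw.unit : GL (Fin N) (w.1.adicCompletion L)) : Matrix (Fin N) (Fin N) (w.1.adicCompletion L)).map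
      (galAdicCompletionMap (L := L) (IsCMField.complexConj L) hw))ᵀ = hJw.unit :=
    placeForm_hermitian_of_smul_eq (IsCMField.complexConj L) w H hHc hw
  constructor
  · rintro ⟨u, hu, rfl⟩
    exact ⟨u, ⟨hJw.unit, hJi, (mem_unitaryGroupOfForm_iff.1 hu).symm⟩, rfl⟩
  · rintro ⟨g, hg, rfl⟩
    obtain ⟨u, hu, k, hk, rfl⟩ := exists_mem_unitaryGroupOfForm_mul_of_selfDual_of_nonsplit (IsCMField.complexConj L) w hc hw hv
      hJw.unit hJi hJh g hg
    refine ⟨u, hu, ?_⟩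
    rw [eq_comm, span_range_transpose_eq_iff, inv_mul_cancel_left]
    exact hk

variable [MeasurableSpace ((cmDatum L N H).Local v)] [BorelSpace ((cmDatum L N H).Local v)]
  [∀ γ : (cmDatum L N H).Local v, MeasurableSpace ((cmDatum L N H).Local v ⧸ Subgroup.centralizer ({γ} : Set ((cmDatum L N H).Local v)))]
  [∀ γ : (cmDatum L N H).Local v, BorelSpace ((cmDatum L N H).Local v ⧸ Subgroup.centralizer ({γ} : Set ((cmDatum L N H).Local v)))]
  (ν : Measure ((cmDatum L N H).Local v)) [Measure.IsHaarMeasure ν] [ν.IsMulRightInvariant]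

/-- **THE LATTICE-COUNT SOCKET — `Φ(⟦γ⟧, 1_{U(H)(𝒪_v)}; m) = #{self-dual 𝒪_w-lattices Λ = g𝒪_wᴺ : γ_w Λ = Λ}`** for `m` CANONICAL (★ `IsCanonical` w.r.t. `IsRegularElt`, `ν`),
`ν(U(H)(𝒪_v)) = 1`, `γ` REGULAR with COMPACT centraliser (elliptic), at a NON-SPLIT place `v` UNRAMIFIED in `L` with `H_w ∈ GL_N(𝒪_w)` (hyperspecial) — every rank
`N`; «self-dual» = unimodular Gram matrix `(σ_w g)ᵀ H_w g ∈ GL_N(𝒪_w)`, `γ_w` = the image of `γ` in `U(σ_w, H_w)(L_w)`.  ★ p839994 ∘ §2 ∘ §3.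
[cite: Rogawski1990, §4.9 Prop. 4.9.1 (b) p. 55] [cite: Kottwitz1986, §3] [cite: Laumon1995, Lemma (5.3.2) p. 136] [cite: Jacobowitz1962, §7 Thm. 7.1] -/
theorem classOrbitalIntegral_indicator_cmLocalIntegralLevel_eq_ncard_selfDual (hH : (H.map (cmConjRingHom L))ᵀ = H) (hdet : H.det ≠ 0)
    {m : OrbitalMeasureFamily ((cmDatum L N H).Local v)} (hm : m.IsCanonical (fun γ => IsRegularElt (γ.val : GL (Fin N) (LocalRing L v))) ν)
    (hν : ν (cmLocalIntegralLevel L N H v : Set ((cmDatum L N H).Local v)) = 1)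
    (γ : (cmDatum L N H).Local v) (hreg : IsRegularElt (γ.val : GL (Fin N) (LocalRing L v)))
    [CompactSpace (Subgroup.centralizer ({γ} : Set ((cmDatum L N H).Local v)))]
    (hv : Algebra.IsUnramifiedIn (𝓞 L) v.asIdeal) (hJw : IsUnit (placeForm H w.1)) (hJi : hJw.unit ∈ glInt N (w.1.adicCompletion L)) :
    classOrbitalIntegral m ((cmLocalIntegralLevel L N H v : Set ((cmDatum L N H).Local v)).indicator (1 : (cmDatum L N H).Local v → ℝ))
        (ConjClasses.mk γ) =
      ({Λ : Submodule 𝒪[w.1.adicCompletion L] (Fin N → w.1.adicCompletion L) |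
        (∃ g : GL (Fin N) (w.1.adicCompletion L),
          (∃ J' ∈ glInt N (w.1.adicCompletion L), (J' : Matrix (Fin N) (Fin N) (w.1.adicCompletion L)) =
            formCongr (galAdicCompletionMap (L := L) (IsCMField.complexConj L) hw) g (placeForm H w.1)) ∧
          Λ = Submodule.span 𝒪[w.1.adicCompletion L] (Set.range ((g : Matrix (Fin N) (Fin N) (w.1.adicCompletion L)))ᵀ)) ∧
        Λ.map ((Matrix.toLin' (((localNonsplitEquiv (IsCMField.complexConj L) H hc w hw γ :
            unitaryGroupOfForm (galAdicCompletionMap (L := L) (IsCMField.complexConj L) hw) (placeForm H w.1)) :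
              GL (Fin N) (w.1.adicCompletion L)) : Matrix (Fin N) (Fin N) (w.1.adicCompletion L))).restrictScalars 𝒪[w.1.adicCompletion L]) = Λ}.ncard : ℝ) := by
  rw [classOrbitalIntegral_indicator_cmLocalIntegralLevel_eq_natCard_fixedBy L N H v ν hH hdet hm hν γ hreg,
    natCard_fixedBy_cmLocalIntegralLevel_eq_ncard_of_smul_eq L N H hc w hw hJw γ]
  congr 2
  ext Λ
  simp only [mem_setOf_eq]
  rw [exists_mem_unitary_span_eq_iff_selfDual_of_nonsplit L N H hc w hw hv hH hJw hJi Λ]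

/-- **THE SOCKET in the letter's `ℂ` currency** (`1_{K_v}` as `fun _ => (1 : ℂ)`, the unit of ★ `IsLocalUnitTransfer`). [cite: Rogawski1990, §4.9 Prop. 4.9.1 (b) p. 55] [cite: Kottwitz1986, §3] -/
theorem classOrbitalIntegral_indicator_complex_cmLocalIntegralLevel_eq_ncard_selfDual (hH : (H.map (cmConjRingHom L))ᵀ = H) (hdet : H.det ≠ 0)
    {m : OrbitalMeasureFamily ((cmDatum L N H).Local v)} (hm : m.IsCanonical (fun γ => IsRegularElt (γ.val : GL (Fin N) (LocalRing L v))) ν)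
    (hν : ν (cmLocalIntegralLevel L N H v : Set ((cmDatum L N H).Local v)) = 1)
    (γ : (cmDatum L N H).Local v) (hreg : IsRegularElt (γ.val : GL (Fin N) (LocalRing L v)))
    [CompactSpace (Subgroup.centralizer ({γ} : Set ((cmDatum L N H).Local v)))]
    (hv : Algebra.IsUnramifiedIn (𝓞 L) v.asIdeal) (hJw : IsUnit (placeForm H w.1)) (hJi : hJw.unit ∈ glInt N (w.1.adicCompletion L)) :
    classOrbitalIntegral m ((cmLocalIntegralLevel L N H v : Set ((cmDatum L N H).Local v)).indicator fun _ => (1 : ℂ)) (ConjClasses.mk γ) =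
      ({Λ : Submodule 𝒪[w.1.adicCompletion L] (Fin N → w.1.adicCompletion L) |
        (∃ g : GL (Fin N) (w.1.adicCompletion L),
          (∃ J' ∈ glInt N (w.1.adicCompletion L), (J' : Matrix (Fin N) (Fin N) (w.1.adicCompletion L)) =
            formCongr (galAdicCompletionMap (L := L) (IsCMField.complexConj L) hw) g (placeForm H w.1)) ∧
          Λ = Submodule.span 𝒪[w.1.adicCompletion L] (Set.range ((g : Matrix (Fin N) (Fin N) (w.1.adicCompletion L)))ᵀ)) ∧
        Λ.map ((Matrix.toLin' (((localNonsplitEquiv (IsCMField.complexConj L) H hc w hw γ :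
            unitaryGroupOfForm (galAdicCompletionMap (L := L) (IsCMField.complexConj L) hw) (placeForm H w.1)) :
              GL (Fin N) (w.1.adicCompletion L)) : Matrix (Fin N) (Fin N) (w.1.adicCompletion L))).restrictScalars 𝒪[w.1.adicCompletion L]) = Λ}.ncard : ℂ) := by
  rw [classOrbitalIntegral_indicator_complex_eq_ofReal,
    classOrbitalIntegral_indicator_cmLocalIntegralLevel_eq_ncard_selfDual L N H hc w hw ν hH hdet hm hν γ hreg hv hJw hJi, Complex.ofReal_natCast]

end Nonsplit

end Literature.NumberTheory.Automorphic

end
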